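/-
Copyright (c) 2026. All rights reserved.
Released under Apache 2.0 license as described in the file LICENSE.
Authors: HodgeCM publication cell (pub-hodgecm), GR lane, seat GR-2 (`pub-hodgecm-own-hyp34`).
-/
import Literature.NumberTheory.Weil1964.ArchUnitaryWeilHalf
import Literature.NumberTheory.Weil1964.ArchMetaplecticTensor
import Literature.NumberTheory.Weil1964.ArchFrameDictionaryGen
import Literature.NumberTheory.Weil1964.ArchComplexPlacesSection
import Literature.NumberTheory.Automorphic.UnitaryGroupArchTopology
import Literature.Analysis.SegalBargmann.SchwartzTensorStrongContinuity
import HarnessLib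

/-!
# The archimedean half of the Weil splitting of ONE adelic unitary group over an ARBITRARY base field:
# `s_∞ : U(J)(F ⊗ ℝ) →* Mp_ψ(W_𝔸)ᶜᵒⁿᵗ` (real places: Folland's `U(p,q)` section; complex places: conjugated Levi)

Topic `NumberTheory/Weil1964`; namespace `Literature.NumberTheory.Weil1964` (continues `ArchUnitaryWeilHalf`).  KERNEL
ONLY: definitions with bodies and theorems; no `def … : Prop` record, no axiom, no proof hole.

`ArchUnitaryWeilHalf` constructs `s_∞` for a totally real base field `F` (every archimedean place of `F` real, under a
complex place of the CM-type extension `E`).  This file removes `[IsTotallyReal F]`: `F` is ANY number field, `E/F`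
quadratic with involution `c` (`c ≠ 1`, `c² = 1`), every REAL place `v` of `F` lies under a `c`-fixed complex place
`w(v)` of `E` (`wOfR`, `hwR`, `hoverR` — automatic when `E` is totally complex) and every COMPLEX place `v` under a
chosen place `w(v)` (`wOf`, `hover`); `J = diag(t₀) ⊗ 1` DIAGONAL, `F`-rational, non-degenerate.  Then, in the twisted
general Folland frame `e := scaledFrameGenT (cxTwist wOf) D_{sign} 1` on `FrameIdx F (Fin N) = (Fin N × {v real}) ⊕
((Fin N ⊕ Fin N) × {v complex})` (`ArchFollandFrameGen/Twist`; sign-frame scalings at the real places as at CM):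

* §1 **`archWeilSectionGen x : U(J)(F ⊗ ℝ) →* Mp^𝓢(ℝ^{FrameIdx})`** := `archWeilSectionS ⊠ cxPlacesSection x`
  (`MpS.tensorHom` of `ArchMetaplecticTensor`: the CM-type section of `ArchUnitaryWeilHalf` §3 on the real block, the
  conjugated Levi section of `ArchComplexPlacesSection` on the complex block, `x` a lift of the realified Cayley
  elements), strongly continuous (`continuous_archWeilSectionGen_apply`, by `SegalBargmann.continuous_tensorOp_apply` —
  Banach–Steinhaus — and `UnitaryGroupArchTopology.instLocallyCompactSpaceArch`);
* §2 **THE DICTIONARY `archPhaseMap (T ⊗ 1) e (ι_𝔸(g, 1)) = ⇑(proj (archWeilSectionGen x g))`**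
  (`archPhaseMap_eq_coe_proj_archWeilSectionGen`): slice by slice on `FrameIdx` (`proj_tensor = spBlock`,
  `coe_spBlock_apply = blockPhase`), the real slices by `ArchFrameDictionaryGen.realSlice_archPhaseMap_adelicToSymplectic` +
  `coe_proj_archWeilSectionS`, the complex slices by `cxSlice_archPhaseMap_archToAdelic` + `coe_proj_cxPlacesSection`;
* §3 **`archWeilHalfGen x hx : U(J)(F ⊗ ℝ) →* Mp_ψ(W_𝔸)ᶜᵒⁿᵗ`** := `archLift` of §1 over `ι_𝔸 ∘ (g ↦ (g, 1))`, with
  `proj_archWeilHalfGen` (`rfl`), `isArch_archWeilHalfGen` (`ω(s_∞ g) = A_g ⊗ 1`), `continuous_archWeilHalfGen`.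

These are the fields `continuous`, `proj_eq`, `isArch` of `GRConstructionGen.IsArchHalf` (the general-`E/F` kernel
construction of [GelbartRogawski1991, Prop. 3.1.1], `DoubledWeilRepresentationArchLiftGen`); the `parabolic` field
(twist `η` and Folland's quotient character of §1) is the sequel.

## References
* [GelbartRogawski1991] S. Gelbart, J. Rogawski, Invent. math. 105 (1991), §3.1 p. 454, Prop. 3.1.1.
* [Weil1964] A. Weil, Acta Math. 111 (1964), Chap. III n° 37–39 pp. 188–190.
* [MoeglinVignerasWaldspurger1987] C. Mœglin, M.-F. Vignéras, J.-L. Waldspurger, LNM 1291 (1987), Chap. 1 I.17–I.19,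
  Chap. 2 II.1–II.2.
* [Folland1989] G. B. Folland, *Harmonic Analysis in Phase Space*, Princeton UP 1989, §1.7, §4.2 (4.24), Prop. (4.39).
* [KonnoKonno2007] K. Konno, T. Konno, Kyushu J. Math. 61 (2007), §3.1 (3.1).
-/

set_option autoImplicit false

noncomputable section

open scoped Matrix Real Classical ComplexConjugate
open Complex NumberField NumberField.InfinitePlace NumberField.mixedEmbedding IsDedekindDomain
open Literature.NumberTheory.Automorphic Literature.NumberTheory.Automorphic.UnitaryGroup
open Literature.RepresentationTheory.HeisenbergGroup Literature.Analysis.SegalBargmann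
open Literature.RepresentationTheory.KonnoKonno2007 Literature.RepresentationTheory.KonnoKonno2007.RealDualPair

namespace Literature.NumberTheory.Weil1964

open MpS UnitaryWeil

local notation "PV" σ => (σ → ℝ) × (σ → ℝ)
local notation "SpR" σ => symplecticGroup (polar (dotPairing σ))

section Gen

variable {F : Type} [Field F] [NumberField F] (E : Type) [Field E] [NumberField E] [Algebra F E]
  [Algebra.IsQuadraticExtension F E] (c : E ≃ₐ[F] E) (N : ℕ) (hc : c ≠ 1) (hcc : c * c = 1)
  (wOfR : {v : InfinitePlace F // v.IsReal} → {w : InfinitePlace E // w.IsComplex})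
  (hwR : ∀ v, c • (wOfR v).1 = (wOfR v).1) (hoverR : ∀ v, (wOfR v).1.comap (algebraMap F E) = v.1)
  (wOf : {v : InfinitePlace F // v.IsComplex} → {w : InfinitePlace E // w.IsComplex})
  (hover : ∀ v, (wOf v).1.comap (algebraMap F E) = v.1)
  (t₀ : Fin N → F) (ht0 : ∀ j, t₀ j ≠ 0) {T : Matrix (Fin N) (Fin N) F} (hTd : T = Matrix.diagonal t₀)
  {J : Matrix (Fin N) (Fin N) E} (hJ : J = T.map (algebraMap F E)) {δ : E} (hcδ : c δ = -δ) (hδ : δ ≠ 0)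
  {d : F} (hd : δ * δ = algebraMap F E d)

omit [NumberField F] [NumberField E] [Algebra.IsQuadraticExtension F E] in
include hTd ht0 in
/-- `det T ≠ 0` for `T = diag(t₀)`, all `t₀ j ≠ 0`. [cite: GelbartRogawski1991, §3.1 p. 454] -/
theorem isUnit_det_of_diagonal : IsUnit T.det := by
  rw [hTd, Matrix.det_diagonal]
  exact isUnit_iff_ne_zero.2 (Finset.prod_ne_zero_iff.2 fun j _ => ht0 j)

omit [NumberField F] [NumberField E] [Algebra.IsQuadraticExtension F E] in
include hTd in
/-- `T = diag(t₀)` is symmetric. [cite: GelbartRogawski1991, §3.1 p. 454] -/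
theorem isSymm_of_diagonal : T.IsSymm := by rw [hTd]; exact Matrix.isSymm_diagonal t₀

/-! ## §1 The section `archWeilSectionS ⊠ cxPlacesSection` -/

/-- **the twisted general Folland frame of `W_∞`**: sign-frame scalings at the real places (as at CM), scaling `1` and
the coordinate twist `placeTwist v w(v)` at the complex places. [cite: Folland1989, §1.3 (1.25); KonnoKonno2007, §3.1] -/
def genFrame : (Fin N → mixedSpace F) ≃L[ℝ] (FrameIdx F (Fin N) → ℝ) :=
  scaledFrameGenT F (Fin N) (cxTwist F E wOf hover) (continuous_cxTwist F E wOf hover)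
    (placeScale N fun v => sqrtAbs (signVec wOfR t₀ δ v))
    (placeScale_ne_zero N (sqrtAbs_signVec_ne_zero hc hwR hcδ hδ ht0)) (fun _ => (1 : ℂ)) (fun _ => one_ne_zero)

/-- **`archWeilSectionGen x : U(J)(F ⊗ ℝ) →* Mp^𝓢(ℝ^{FrameIdx})`** := `archWeilSectionS ⊠ cxPlacesSection x`.
[cite: GelbartRogawski1991, §3.1 p. 454; MoeglinVignerasWaldspurger1987, Chap. 2 II.1] -/
def archWeilSectionGen (x : MpS ((Fin N ⊕ Fin N) × {v : InfinitePlace F // v.IsComplex})) :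
    UnitaryGroup.arch F E c N J →* MpS (FrameIdx F (Fin N)) :=
  MpS.tensorHom.comp ((archWeilSectionS E c N hc wOfR hwR hoverR t₀ ht0 hTd hJ hcδ hδ).prod
    (cxPlacesSection F E c hcc N T hJ hδ wOf x))

omit [Algebra.IsQuadraticExtension F E] in
/-- unfolding: `archWeilSectionGen x g = archWeilSectionS g ⊠ cxPlacesSection x g`. [cite: MoeglinVignerasWaldspurger1987, Chap. 2 II.1] -/
theorem archWeilSectionGen_apply (x : MpS ((Fin N ⊕ Fin N) × {v : InfinitePlace F // v.IsComplex}))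
    (g : UnitaryGroup.arch F E c N J) :
    archWeilSectionGen E c N hc hcc wOfR hwR hoverR wOf t₀ ht0 hTd hJ hcδ hδ x g =
      MpS.tensor (archWeilSectionS E c N hc wOfR hwR hoverR t₀ ht0 hTd hJ hcδ hδ g)
        (cxPlacesSection F E c hcc N T hJ hδ wOf x g) :=
  rfl

omit [Algebra.IsQuadraticExtension F E] in
/-- **strong continuity of the section** (Banach–Steinhaus for the tensor of the two strongly continuous blocks;
`U(J)(F ⊗ ℝ)` is locally compact). [cite: Folland1989, §1.7; Weil1964, Chap. III n° 39 p. 189] -/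
theorem continuous_archWeilSectionGen_apply (x : MpS ((Fin N ⊕ Fin N) × {v : InfinitePlace F // v.IsComplex}))
    (f : SchwartzMap (FrameIdx F (Fin N) → ℝ) ℂ) :
    Continuous fun g : UnitaryGroup.arch F E c N J =>
      (archWeilSectionGen E c N hc hcc wOfR hwR hoverR wOf t₀ ht0 hTd hJ hcδ hδ x g).1.2 f := by
  have h := continuous_tensorOp_apply
    (fun g : UnitaryGroup.arch F E c N J =>
      ((archWeilSectionS E c N hc wOfR hwR hoverR t₀ ht0 hTd hJ hcδ hδ g).1.2 :
        (SchwartzMap (Fin N × {v : InfinitePlace F // v.IsReal} → ℝ) ℂ) →L[ℂ]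
          SchwartzMap (Fin N × {v : InfinitePlace F // v.IsReal} → ℝ) ℂ))
    (fun g : UnitaryGroup.arch F E c N J =>
      ((cxPlacesSection F E c hcc N T hJ hδ wOf x g).1.2 :
        (SchwartzMap ((Fin N ⊕ Fin N) × {v : InfinitePlace F // v.IsComplex} → ℝ) ℂ) →L[ℂ]
          SchwartzMap ((Fin N ⊕ Fin N) × {v : InfinitePlace F // v.IsComplex} → ℝ) ℂ))
    (fun f => continuous_archWeilSectionS_apply E c N hc wOfR hwR hoverR t₀ ht0 hTd hJ hcδ hδ f)
    (fun f => continuous_cxPlacesSection_snd_apply F E c hcc N T hJ hδ wOf x f) f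
  have h' : (fun g : UnitaryGroup.arch F E c N J =>
      (archWeilSectionGen E c N hc hcc wOfR hwR hoverR wOf t₀ ht0 hTd hJ hcδ hδ x g).1.2 f) =
      (fun gg : UnitaryGroup.arch F E c N J × UnitaryGroup.arch F E c N J =>
        tensorOp ((archWeilSectionS E c N hc wOfR hwR hoverR t₀ ht0 hTd hJ hcδ hδ gg.1).1.2 :
          (SchwartzMap (Fin N × {v : InfinitePlace F // v.IsReal} → ℝ) ℂ) →L[ℂ]
            SchwartzMap (Fin N × {v : InfinitePlace F // v.IsReal} → ℝ) ℂ)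
          ((cxPlacesSection F E c hcc N T hJ hδ wOf x gg.2).1.2 :
          (SchwartzMap ((Fin N ⊕ Fin N) × {v : InfinitePlace F // v.IsComplex} → ℝ) ℂ) →L[ℂ]
            SchwartzMap ((Fin N ⊕ Fin N) × {v : InfinitePlace F // v.IsComplex} → ℝ) ℂ) f) ∘
        fun g => (g, g) := by
    funext g
    exact MpS.tensor_apply _ _ f
  rw [h']
  exact h.comp (continuous_id.prodMk continuous_id)

/-! ## §2 The dictionary -/

include hd in
/-- **THE DICTIONARY, general `F`**: in the twisted general frame the archimedean phase map of `ι_𝔸(g, 1)` IS the phase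
action of `archWeilSectionGen x g` (for a lift `x` of the realified Cayley elements), slice by slice: real slices =
Konno–Konno's `U(P_v, Q_v) ↪ Sp` of the `w(v)`-components, complex slices = the realified conjugated Levi of the
`w(v)`-components. [cite: GelbartRogawski1991, §3.1 p. 454; KonnoKonno2007, §3.1 (3.1); MoeglinVignerasWaldspurger1987,
Chap. 1 I.17; Folland1989, Ch. 4 §1, Prop. (4.6)] -/
theorem archPhaseMap_eq_coe_proj_archWeilSectionGen (x : MpS ((Fin N ⊕ Fin N) × {v : InfinitePlace F // v.IsComplex}))
    (hx : MpS.proj x = placeSp fun v => (cxKappaFamily F E N T (isSymm_of_diagonal N t₀ hTd)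
      (isUnit_det_of_diagonal N t₀ ht0 hTd) hδ wOf v)⁻¹)
    (hTu : IsUnit (archMat F (Fin N) (T.map (algebraMap F (AdeleRing (𝓞 F) F))))) (g : UnitaryGroup.arch F E c N J) :
    archPhaseMap (T.map (algebraMap F (AdeleRing (𝓞 F) F)))
        (genFrame E c N hc wOfR hwR wOf hover t₀ ht0 hcδ hδ) hTu
        (((adelicToSymplectic F E c N hcδ hδ hd (isSymm_of_diagonal N t₀ hTd) hJ).comp (UnitaryGroup.archToAdelic F E c N J)) g) =
      ⇑(((MpS.proj (archWeilSectionGen E c N hc hcc wOfR hwR hoverR wOf t₀ ht0 hTd hJ hcδ hδ x g)).1 :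
        (PV (FrameIdx F (Fin N))) ≃ₗ[ℝ] PV (FrameIdx F (Fin N)))) := by
  have hcx := coe_proj_cxPlacesSection F E c hcc N T (isSymm_of_diagonal N t₀ hTd) (isUnit_det_of_diagonal N t₀ ht0 hTd)
    hJ hδ wOf x hx g
  rw [archWeilSectionGen_apply, MpS.proj_tensor, coe_spBlock_apply, coe_proj_archWeilSectionS, hcx]
  subst hTd
  funext pq
  refine Prod.ext (funext fun k => ?_) (funext fun k => ?_)
  · rcases k with ⟨j, v⟩ | ⟨i, v⟩
    · have key := realSlice_archPhaseMap_adelicToSymplectic E c N hc wOfR hwR hoverR t₀ hJ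
        (fun v => signSplit (signVec wOfR t₀ δ v)) (D := fun v => sqrtAbs (signVec wOfR t₀ δ v))
        (sqrtAbs_signVec_ne_zero hc hwR hcδ hδ ht0) (c' := deltaIm wOfR δ) (deltaIm_ne_zero hc hwR hcδ hδ)
        (ht_signVec hc hwR hcδ hδ ht0) (cxTwist F E wOf hover) (continuous_cxTwist F E wOf hover) (fun _ => (1 : ℂ))
        (fun _ => one_ne_zero) hcδ hδ hd (Matrix.isSymm_diagonal t₀) (fun v => rfl) hTu v (UnitaryGroup.archToAdelic F E c N J g) pq
      have h1 := congrArg (fun PQ : PV (Fin N) => PQ.1 j) key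
      simp only [realSlice_apply] at h1
      rw [MonoidHom.comp_apply]
      refine h1.trans ?_
      rw [UForm.coe_toSp]
      rfl
    · have key := cxSlice_archPhaseMap_archToAdelic F E c hcc N hcδ hδ hd (Matrix.diagonal t₀) (Matrix.isSymm_diagonal t₀)
        (isUnit_det_of_diagonal N t₀ ht0 rfl) hJ wOf hover (placeScale N fun v => sqrtAbs (signVec wOfR t₀ δ v))
        (placeScale_ne_zero N (sqrtAbs_signVec_ne_zero hc hwR hcδ hδ ht0)) hTu v g pq
      have h1 := congrArg (fun PQ : PV (Fin N ⊕ Fin N) => PQ.1 i) key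
      simp only [cxSlice_apply] at h1
      rw [MonoidHom.comp_apply]
      exact h1
  · rcases k with ⟨j, v⟩ | ⟨i, v⟩
    · have key := realSlice_archPhaseMap_adelicToSymplectic E c N hc wOfR hwR hoverR t₀ hJ
        (fun v => signSplit (signVec wOfR t₀ δ v)) (D := fun v => sqrtAbs (signVec wOfR t₀ δ v))
        (sqrtAbs_signVec_ne_zero hc hwR hcδ hδ ht0) (c' := deltaIm wOfR δ) (deltaIm_ne_zero hc hwR hcδ hδ)
        (ht_signVec hc hwR hcδ hδ ht0) (cxTwist F E wOf hover) (continuous_cxTwist F E wOf hover) (fun _ => (1 : ℂ))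
        (fun _ => one_ne_zero) hcδ hδ hd (Matrix.isSymm_diagonal t₀) (fun v => rfl) hTu v (UnitaryGroup.archToAdelic F E c N J g) pq
      have h1 := congrArg (fun PQ : PV (Fin N) => PQ.2 j) key
      simp only [realSlice_apply] at h1
      rw [MonoidHom.comp_apply]
      refine h1.trans ?_
      rw [UForm.coe_toSp]
      rfl
    · have key := cxSlice_archPhaseMap_archToAdelic F E c hcc N hcδ hδ hd (Matrix.diagonal t₀) (Matrix.isSymm_diagonal t₀)
        (isUnit_det_of_diagonal N t₀ ht0 rfl) hJ wOf hover (placeScale N fun v => sqrtAbs (signVec wOfR t₀ δ v))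
        (placeScale_ne_zero N (sqrtAbs_signVec_ne_zero hc hwR hcδ hδ ht0)) hTu v g pq
      have h1 := congrArg (fun PQ : PV (Fin N ⊕ Fin N) => PQ.2 i) key
      simp only [cxSlice_apply] at h1
      rw [MonoidHom.comp_apply]
      exact h1

/-! ## §3 The archimedean half `s_∞ : U(J)(F ⊗ ℝ) →* Mp_ψ(W_𝔸)ᶜᵒⁿᵗ` -/

/-- **`archWeilHalfGen x hx : U(J)(F ⊗ ℝ) →* Mp_ψ(W_𝔸)ᶜᵒⁿᵗ`**, `g ↦ (ι_𝔸(g, 1), (e^* s(g) e_*) ⊗ 1)` — the archimedean half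
of the metaplectic splitting of `U(J)(𝔸_F)` over a general number field `F`.
[cite: GelbartRogawski1991, §3.1 p. 454, Prop. 3.1.1; Weil1964, Chap. III n° 37–39] -/
def archWeilHalfGen (x : MpS ((Fin N ⊕ Fin N) × {v : InfinitePlace F // v.IsComplex}))
    (hx : MpS.proj x = placeSp fun v => (cxKappaFamily F E N T (isSymm_of_diagonal N t₀ hTd)
      (isUnit_det_of_diagonal N t₀ ht0 hTd) hδ wOf v)⁻¹)
    (hTu : IsUnit (archMat F (Fin N) (T.map (algebraMap F (AdeleRing (𝓞 F) F))))) :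
    UnitaryGroup.arch F E c N J →* adelicMpCont F (Fin N) (T.map (algebraMap F (AdeleRing (𝓞 F) F))) :=
  archLift (T.map (algebraMap F (AdeleRing (𝓞 F) F))) (genFrame E c N hc wOfR hwR wOf hover t₀ ht0 hcδ hδ) hTu
    ((adelicToSymplectic F E c N hcδ hδ hd (isSymm_of_diagonal N t₀ hTd) hJ).comp (UnitaryGroup.archToAdelic F E c N J))
    (archWeilSectionGen E c N hc hcc wOfR hwR hoverR wOf t₀ ht0 hTd hJ hcδ hδ x)
    (adelicToSymplectic_comp_archToAdelic_finVec E c N hJ hcδ hδ hd (isSymm_of_diagonal N t₀ hTd))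
    (archPhaseMap_eq_coe_proj_archWeilSectionGen E c N hc hcc wOfR hwR hoverR wOf hover t₀ ht0 hTd hJ hcδ hδ hd x hx hTu)

/-- **`proj (s_∞ g) = ι_𝔸(g, 1)`** (field `proj_eq`). [cite: GelbartRogawski1991, §3.1 p. 454] -/
@[simp] theorem proj_archWeilHalfGen (x : MpS ((Fin N ⊕ Fin N) × {v : InfinitePlace F // v.IsComplex}))
    (hx : MpS.proj x = placeSp fun v => (cxKappaFamily F E N T (isSymm_of_diagonal N t₀ hTd)
      (isUnit_det_of_diagonal N t₀ ht0 hTd) hδ wOf v)⁻¹)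
    (hTu : IsUnit (archMat F (Fin N) (T.map (algebraMap F (AdeleRing (𝓞 F) F))))) (g : UnitaryGroup.arch F E c N J) :
    adelicMpCont.proj F (Fin N) _ (archWeilHalfGen E c N hc hcc wOfR hwR hoverR wOf hover t₀ ht0 hTd hJ hcδ hδ hd x hx hTu g) =
      adelicToSymplectic F E c N hcδ hδ hd (isSymm_of_diagonal N t₀ hTd) hJ (UnitaryGroup.archToAdelic F E c N J g) := rfl

/-- **`ω(s_∞ g) = A_g ⊗ 1` is archimedean** (field `isArch`). [cite: Weil1964, Chap. III n° 38 p. 189] -/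
theorem isArch_archWeilHalfGen (x : MpS ((Fin N ⊕ Fin N) × {v : InfinitePlace F // v.IsComplex}))
    (hx : MpS.proj x = placeSp fun v => (cxKappaFamily F E N T (isSymm_of_diagonal N t₀ hTd)
      (isUnit_det_of_diagonal N t₀ ht0 hTd) hδ wOf v)⁻¹)
    (hTu : IsUnit (archMat F (Fin N) (T.map (algebraMap F (AdeleRing (𝓞 F) F))))) (g : UnitaryGroup.arch F E c N J) :
    ∃ A : SchwartzMap (Fin N → mixedSpace F) ℂ →L[ℂ] SchwartzMap (Fin N → mixedSpace F) ℂ,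
      (adelicMpCont.omega F (Fin N) _ (archWeilHalfGen E c N hc hcc wOfR hwR hoverR wOf hover t₀ ht0 hTd hJ hcδ hδ hd x hx hTu g) :
          piSchwartzBruhat F (Fin N) →ₗ[ℂ] piSchwartzBruhat F (Fin N)) =
        adelicTensorEnd (A : SchwartzMap (Fin N → mixedSpace F) ℂ →ₗ[ℂ] SchwartzMap (Fin N → mixedSpace F) ℂ) LinearMap.id :=
  isArch_archLift _ _ _ _ _ _ _ g

/-- the archimedean operator explicitly: `e^* ∘ (archWeilSectionGen x g) ∘ e_*`. [cite: Weil1964, Chap. III n° 38 p. 189] -/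
theorem omega_archWeilHalfGen (x : MpS ((Fin N ⊕ Fin N) × {v : InfinitePlace F // v.IsComplex}))
    (hx : MpS.proj x = placeSp fun v => (cxKappaFamily F E N T (isSymm_of_diagonal N t₀ hTd)
      (isUnit_det_of_diagonal N t₀ ht0 hTd) hδ wOf v)⁻¹)
    (hTu : IsUnit (archMat F (Fin N) (T.map (algebraMap F (AdeleRing (𝓞 F) F))))) (g : UnitaryGroup.arch F E c N J) :
    (adelicMpCont.omega F (Fin N) _ (archWeilHalfGen E c N hc hcc wOfR hwR hoverR wOf hover t₀ ht0 hTd hJ hcδ hδ hd x hx hTu g) :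
        piSchwartzBruhat F (Fin N) →ₗ[ℂ] piSchwartzBruhat F (Fin N)) =
      adelicTensorEnd ((carrierConjEquiv (genFrame E c N hc wOfR hwR wOf hover t₀ ht0 hcδ hδ)
          (archWeilSectionGen E c N hc hcc wOfR hwR hoverR wOf t₀ ht0 hTd hJ hcδ hδ x g).1.2 :
          SchwartzMap (Fin N → mixedSpace F) ℂ →L[ℂ] SchwartzMap (Fin N → mixedSpace F) ℂ) :
        SchwartzMap (Fin N → mixedSpace F) ℂ →ₗ[ℂ] SchwartzMap (Fin N → mixedSpace F) ℂ) LinearMap.id :=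
  rfl

/-- **`s_∞` is continuous** (field `continuous`). [cite: Weil1964, Chap. III n° 39 p. 189; Folland1989, §1.7] -/
theorem continuous_archWeilHalfGen (x : MpS ((Fin N ⊕ Fin N) × {v : InfinitePlace F // v.IsComplex}))
    (hx : MpS.proj x = placeSp fun v => (cxKappaFamily F E N T (isSymm_of_diagonal N t₀ hTd)
      (isUnit_det_of_diagonal N t₀ ht0 hTd) hδ wOf v)⁻¹)
    (hTu : IsUnit (archMat F (Fin N) (T.map (algebraMap F (AdeleRing (𝓞 F) F))))) :
    Continuous (archWeilHalfGen E c N hc hcc wOfR hwR hoverR wOf hover t₀ ht0 hTd hJ hcδ hδ hd x hx hTu) :=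
  continuous_archLift _ _ _ _ _ _ _
    (fun w => (continuous_adelicToSymplectic_apply F E c (N := N) hcδ hδ hd (isSymm_of_diagonal N t₀ hTd) hJ w).comp
      (UnitaryGroup.continuous_archToAdelic F E c N J))
    (continuous_archWeilSectionGen_apply E c N hc hcc wOfR hwR hoverR wOf t₀ ht0 hTd hJ hcδ hδ x)

omit [NumberField E] [Algebra.IsQuadraticExtension F E] in
/-- **a lift `x` of the realified Cayley elements exists**, hence so does `s_∞`. [cite: Folland1989, §4.2 Prop. (4.39)] -/
theorem exists_archWeilHalfGen_lift :
    ∃ x : MpS ((Fin N ⊕ Fin N) × {v : InfinitePlace F // v.IsComplex}),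
      MpS.proj x = placeSp fun v => (cxKappaFamily F E N T (isSymm_of_diagonal N t₀ hTd)
        (isUnit_det_of_diagonal N t₀ ht0 hTd) hδ wOf v)⁻¹ :=
  exists_cxPlacesSection_lift F E N T _ _ hδ wOf

end Gen

end Literature.NumberTheory.Weil1964

end
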